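import Summits.CriticalPhenomena.PercolationContinuityZ3.Theorems.PercNearOneGluingNoHeavyLowerTailSahiGridPatternCoLiftPrelim

/-!
# `NoHeavyLowerTail` (crux stmt-CriticalPhenomena-4575), Sahi programme: **THE SHARPENED MID-TOP LIFT `(∅,D,⊤)`, EVERY DIMENSION** —
# `sStarD D B₁ C₁ + sStarD D B₂ C₂ + 2·sStarD ⊤ B₂ C₂ ≤ sStarD A B C`

Support file (lineage `prim-master-conj`, generation 48; `--supports stmt-CriticalPhenomena-4575`).  Pure proofs, no definitions,
no `sorry`, standard axioms.  Vocabulary of `…SahiGridPattern{TwoLayerTop,Orthant,CoLiftPrelim}` (`sStarD`, `ind`, `TotDist`,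
`thirdPt`, `block_eq`, the normalisation lemmas); companion of the co-lift `…SahiGridPatternMidTop` (seat `prim-sahi-p1`, gen 9).

THE MATHEMATICS.  Slice an up-set `A ⊆ [3]^{n+1}` along the last axis, `A_l = {q : snoc q l ∈ A}`, and write `B_l, C_l` for the
slices of the (arbitrary) up-sets `B, C`.  P1's MID-TOP LIFT says that for the pattern `(A₀,A₁,A₂) = (∅, D, ⊤)`
`sStarD D B₁ C₂ + sStarD D B₂ C₁ ≤ sStarD A B C`.  THEOREM (`sum_sStarD_le_of_midTop_sharp`, every `n`): for the same pattern also
    `sStarD D B₁ C₁ + sStarD D B₂ C₂ + 2 · sStarD ⊤ B₂ C₂ ≤ sStarD A B C`,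
i.e. the `(n+1)`-dimensional functional dominates the DIAGONAL section functionals of the middle and top levels plus twice the
coefficientwise Harris form `sStarD ⊤ B₂ C₂ = 2^n |B₂ ∩ C₂| − N(B₂, C₂)` of the top slices.  This is the `(∅,D,⊤)` case of the
'section-lift' inequality `κ_{n+1}(a,b,c) ≥ κ_n(a₁,b₁,c₁) + 2κ_n(a₂,b₂,c₂)` for slots with a full top slice (lineage memo
`run/shared/lean/prim/prim-l12/FROM-prim-master-conj-g48-SECTION-LIFTS.md`: numerically valid through `d = 6`, NOT cellwise-certifiable for a
general middle/bottom pair `(A₀,A₁)`, certifiable here), with the extra diagonal term `sStarD D B₂ C₂`.  In particular `A` is a good first slot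
whenever `D` is, with an explicit quantitative surplus.
PROOF.  An exact integer certificate found by LP over the one-explicit-axis type frame (kit j282733; all multipliers `1`): after the
27-block expansion of `sStarD A B C` (`block_eq`, as in `…MidTop`) and the counting form of the three left-hand terms, the difference is the
sum of the two fibre-Kleitman slacks of `…MidTop` (`sum_ind_lat_le_td` with free first argument `B₁∖B₀`, resp. `C₁∖C₀`) and thirteen
sums of products of nonnegative increments; `linarith` assembles them. [this work]
-/

namespace Summit.CriticalPhenomena.PercolationContinuityZ3.Theorems.SahiGridPattern

open Finset SahiGrid3
open scoped BigOperators

variable {n : ℕ}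

set_option maxHeartbeats 1000000 in
/-- **SHARPENED MID-TOP LIFT** (every `n`): if the up-set `A ⊆ [3]^{n+1}` misses the bottom level, contains the whole top level, and
has middle slice `D` (pattern `(∅,D,⊤)`), then for ARBITRARY up-sets `B, C ⊆ [3]^{n+1}` with slices `B_l, C_l`,
`sStarD D B₁ C₁ + sStarD D B₂ C₂ + 2·sStarD ⊤ B₂ C₂ ≤ sStarD A B C`.  (Exact LP certificate, kit j282733.) [this work] -/
theorem sum_sStarD_le_of_midTop_sharp (A B C : Finset (Pd (n + 1)))
    (hA : IsUpperSet (A : Set (Pd (n + 1)))) (hB : IsUpperSet (B : Set (Pd (n + 1)))) (hC : IsUpperSet (C : Set (Pd (n + 1))))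
    (hA0 : ∀ q : Pd n, (Fin.snoc q 0 : Pd (n + 1)) ∉ A) (hA2 : ∀ q : Pd n, (Fin.snoc q 2 : Pd (n + 1)) ∈ A) :
    sStarD (univ.filter fun q : Pd n => (Fin.snoc q 1 : Pd (n + 1)) ∈ A) (univ.filter fun q : Pd n => (Fin.snoc q 1 : Pd (n + 1)) ∈ B) (univ.filter fun q : Pd n => (Fin.snoc q 1 : Pd (n + 1)) ∈ C)
      + sStarD (univ.filter fun q : Pd n => (Fin.snoc q 1 : Pd (n + 1)) ∈ A) (univ.filter fun q : Pd n => (Fin.snoc q 2 : Pd (n + 1)) ∈ B) (univ.filter fun q : Pd n => (Fin.snoc q 2 : Pd (n + 1)) ∈ C)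
      + 2 * sStarD (univ : Finset (Pd n)) (univ.filter fun q : Pd n => (Fin.snoc q 2 : Pd (n + 1)) ∈ B) (univ.filter fun q : Pd n => (Fin.snoc q 2 : Pd (n + 1)) ∈ C)
      ≤ sStarD A B C := by
  set D : Finset (Pd n) := (univ.filter fun q : Pd n => (Fin.snoc q 1 : Pd (n + 1)) ∈ A) with hDdef
  set P0 : Finset (Pd n) := (univ.filter fun q : Pd n => (Fin.snoc q 0 : Pd (n + 1)) ∈ B) with hP0def
  set P1 : Finset (Pd n) := (univ.filter fun q : Pd n => (Fin.snoc q 1 : Pd (n + 1)) ∈ B) with hP1def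
  set P2 : Finset (Pd n) := (univ.filter fun q : Pd n => (Fin.snoc q 2 : Pd (n + 1)) ∈ B) with hP2def
  set Q0 : Finset (Pd n) := (univ.filter fun q : Pd n => (Fin.snoc q 0 : Pd (n + 1)) ∈ C) with hQ0def
  set Q1 : Finset (Pd n) := (univ.filter fun q : Pd n => (Fin.snoc q 1 : Pd (n + 1)) ∈ C) with hQ1def
  set Q2 : Finset (Pd n) := (univ.filter fun q : Pd n => (Fin.snoc q 2 : Pd (n + 1)) ∈ C) with hQ2def
  have iA0 : ∀ p, ind A (Fin.snoc p 0) = 0 := fun p => by unfold ind; rw [if_neg (hA0 p)]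
  have iA1 : ∀ p, ind A (Fin.snoc p 1) = ind D p := fun p => by rw [hDdef, ind_filter_snoc]
  have iA2 : ∀ p, ind A (Fin.snoc p 2) = ind (univ : Finset (Pd n)) p := fun p => by
    unfold ind; rw [if_pos (hA2 p), if_pos (Finset.mem_univ _)]
  have iP0 : ∀ p, ind B (Fin.snoc p 0) = ind P0 p := fun p => by rw [hP0def, ind_filter_snoc]
  have iP1 : ∀ p, ind B (Fin.snoc p 1) = ind P1 p := fun p => by rw [hP1def, ind_filter_snoc]
  have iP2 : ∀ p, ind B (Fin.snoc p 2) = ind P2 p := fun p => by rw [hP2def, ind_filter_snoc]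
  have iQ0 : ∀ p, ind C (Fin.snoc p 0) = ind Q0 p := fun p => by rw [hQ0def, ind_filter_snoc]
  have iQ1 : ∀ p, ind C (Fin.snoc p 1) = ind Q1 p := fun p => by rw [hQ1def, ind_filter_snoc]
  have iQ2 : ∀ p, ind C (Fin.snoc p 2) = ind Q2 p := fun p => by rw [hQ2def, ind_filter_snoc]
  have hDup : IsUpperSet (D : Set (Pd n)) := by rw [hDdef]; exact isUpperSet_filter_snoc hA 1
  have hUup : IsUpperSet ((univ : Finset (Pd n)) : Set (Pd n)) := by rw [Finset.coe_univ]; exact isUpperSet_univ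
  have hP0up : IsUpperSet (P0 : Set (Pd n)) := by rw [hP0def]; exact isUpperSet_filter_snoc hB 0
  have hP1up : IsUpperSet (P1 : Set (Pd n)) := by rw [hP1def]; exact isUpperSet_filter_snoc hB 1
  have hP2up : IsUpperSet (P2 : Set (Pd n)) := by rw [hP2def]; exact isUpperSet_filter_snoc hB 2
  have hQ0up : IsUpperSet (Q0 : Set (Pd n)) := by rw [hQ0def]; exact isUpperSet_filter_snoc hC 0
  have hQ1up : IsUpperSet (Q1 : Set (Pd n)) := by rw [hQ1def]; exact isUpperSet_filter_snoc hC 1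
  have hQ2up : IsUpperSet (Q2 : Set (Pd n)) := by rw [hQ2def]; exact isUpperSet_filter_snoc hC 2
  have nP01 : ∀ p, ind P0 p ≤ ind P1 p := fun p => by rw [← iP0, ← iP1]; exact ind_snoc_mono hB p (by decide)
  have sP01 : P0 ⊆ P1 := subset_of_ind_le nP01
  have nP12 : ∀ p, ind P1 p ≤ ind P2 p := fun p => by rw [← iP1, ← iP2]; exact ind_snoc_mono hB p (by decide)
  have sP12 : P1 ⊆ P2 := subset_of_ind_le nP12
  have nP02 : ∀ p, ind P0 p ≤ ind P2 p := fun p => by rw [← iP0, ← iP2]; exact ind_snoc_mono hB p (by decide)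
  have sP02 : P0 ⊆ P2 := subset_of_ind_le nP02
  have nQ01 : ∀ p, ind Q0 p ≤ ind Q1 p := fun p => by rw [← iQ0, ← iQ1]; exact ind_snoc_mono hC p (by decide)
  have sQ01 : Q0 ⊆ Q1 := subset_of_ind_le nQ01
  have nQ12 : ∀ p, ind Q1 p ≤ ind Q2 p := fun p => by rw [← iQ1, ← iQ2]; exact ind_snoc_mono hC p (by decide)
  have sQ12 : Q1 ⊆ Q2 := subset_of_ind_le nQ12
  have nQ02 : ∀ p, ind Q0 p ≤ ind Q2 p := fun p => by rw [← iQ0, ← iQ2]; exact ind_snoc_mono hC p (by decide)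
  have sQ02 : Q0 ⊆ Q2 := subset_of_ind_le nQ02
  have nDU : ∀ p, ind D p ≤ ind (univ : Finset (Pd n)) p := fun p => by
    unfold ind; rw [if_pos (Finset.mem_univ p)]; split_ifs <;> norm_num
  have sDU : D ⊆ (univ : Finset (Pd n)) := Finset.subset_univ D
  have eA : sStarD A B C =
      - (∑ p, ∑ q, ind D p * ind P0 q * ind Q0 q * (if TotDist p q = true then (1:ℤ) else 0))
      - (∑ p, ∑ q, ind P0 p * ind D q * ind Q1 q * (if TotDist p q = true then (1:ℤ) else 0))
      + (∑ q, ∑ r, ind P0 q * ind Q2 r * ind D (thirdPt q r) * (if TotDist q r = true then (1:ℤ) else 0))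
      - (∑ p, ∑ q, ind Q0 p * ind D q * ind P1 q * (if TotDist p q = true then (1:ℤ) else 0))
      + 4 * 2 ^ n * (∑ p, ind D p * ind P1 p * ind Q1 p)
      - (∑ p, ∑ q, ind Q2 p * ind D q * ind P1 q * (if TotDist p q = true then (1:ℤ) else 0))
      + (∑ q, ∑ r, ind P2 q * ind Q0 r * ind D (thirdPt q r) * (if TotDist q r = true then (1:ℤ) else 0))
      - (∑ p, ∑ q, ind P2 p * ind D q * ind Q1 q * (if TotDist p q = true then (1:ℤ) else 0))
      - (∑ p, ∑ q, ind D p * ind P2 q * ind Q2 q * (if TotDist p q = true then (1:ℤ) else 0))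
      - (∑ p, ∑ q, ind (univ : Finset (Pd n)) p * ind P0 q * ind Q0 q * (if TotDist p q = true then (1:ℤ) else 0))
      + (∑ q, ∑ r, ind P0 q * ind Q1 r * ind (univ : Finset (Pd n)) (thirdPt q r) * (if TotDist q r = true then (1:ℤ) else 0))
      - (∑ p, ∑ q, ind P0 p * ind (univ : Finset (Pd n)) q * ind Q2 q * (if TotDist p q = true then (1:ℤ) else 0))
      + (∑ q, ∑ r, ind P1 q * ind Q0 r * ind (univ : Finset (Pd n)) (thirdPt q r) * (if TotDist q r = true then (1:ℤ) else 0))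
      - (∑ p, ∑ q, ind (univ : Finset (Pd n)) p * ind P1 q * ind Q1 q * (if TotDist p q = true then (1:ℤ) else 0))
      - (∑ p, ∑ q, ind P1 p * ind (univ : Finset (Pd n)) q * ind Q2 q * (if TotDist p q = true then (1:ℤ) else 0))
      - (∑ p, ∑ q, ind Q0 p * ind (univ : Finset (Pd n)) q * ind P2 q * (if TotDist p q = true then (1:ℤ) else 0))
      - (∑ p, ∑ q, ind Q1 p * ind (univ : Finset (Pd n)) q * ind P2 q * (if TotDist p q = true then (1:ℤ) else 0))
      + 4 * 2 ^ n * (∑ p, ind (univ : Finset (Pd n)) p * ind P2 p * ind Q2 p) := by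
    rw [sStarD_eq_sum_ind]
    simp only [sum_snoc, Fin.sum_univ_three, iA0, iA1, iA2, iP0, iP1, iP2, iQ0, iQ1, iQ2, zero_mul,
      Finset.sum_const_zero, zero_add, Finset.sum_add_distrib]
    rw [block_eq, block_eq, block_eq, block_eq, block_eq, block_eq, block_eq, block_eq, block_eq, block_eq, block_eq, block_eq, block_eq, block_eq, block_eq, block_eq, block_eq, block_eq]
    obtain ⟨h0, h1, h2, h3, h4, h5, h6, h7, h8, h9, h10, h11, h12, h13, h14, h15, h16, h17, h18, h19, h20, h21, h22, h23, h24, h25, h26, h27, h28, h29, h30, h31, h32, h33, h34, h35, h36, h37, h38, h39, h40, h41, h42, h43, h44, h45, h46, h47, h48, h49, h50, h51, h52, h53, h54, h55, h56, h57, h58, h59⟩ := c_vals_liftTwo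
    simp only [h0, h1, h2, h3, h4, h5, h6, h7, h8, h9, h10, h11, h12, h13, h14, h15, h16, h17, h18, h19, h20, h21, h22, h23, h24, h25, h26, h27, h28, h29, h30, h31, h32, h33, h34, h35, h36, h37, h38, h39, h40, h41, h42, h43, h44, h45, h46, h47, h48, h49, h50, h51, h52, h53, h54, h55, h56, h57, h58, h59]
    ring
  have eS_A1_P1_Q1 := sStarD_counting D P1 Q1
  have eS_A1_P2_Q2 := sStarD_counting D P2 Q2
  have eS_U_P2_Q2 := sStarD_counting (univ : Finset (Pd n)) P2 Q2
  have fS_A2_P2_Q2 := sum_ind_totDist_le n P2 Q2 hP2up hQ2up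
  have fkB112 := sum_ind_lat_le_td (P1 \ P0) hQ2up hDup
  rw [sum2_ind_sdiff_first sP01, sum2_ind_sdiff_first sP01] at fkB112
  rw [reord2 P1 Q2 D, reord2 P0 Q2 D] at fkB112
  have fkC111 := sum_ind_lat_le_td (Q1 \ Q0) hP1up hDup
  rw [sum2_ind_sdiff_first sQ01, sum2_ind_sdiff_first sQ01] at fkC111
  rw [swapL P1 Q1 D, swapL P1 Q0 D, reord2 Q1 P1 D, reord2 Q0 P1 D] at fkC111
  have fp0 : 0 ≤ (∑ p, ∑ q, ind D p * ind P1 q * ind Q1 q * (if TotDist p q = true then (1:ℤ) else 0)) - (∑ p, ∑ q, ind D p * ind P1 q * ind Q0 q * (if TotDist p q = true then (1:ℤ) else 0)) := by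
    have e : (∑ p, ∑ q, ind D p * ind P1 q * (ind Q1 q - ind Q0 q) * (if TotDist p q = true then (1:ℤ) else 0)) = ((∑ p, ∑ q, ind D p * ind P1 q * ind Q1 q * (if TotDist p q = true then (1:ℤ) else 0)) - (∑ p, ∑ q, ind D p * ind P1 q * ind Q0 q * (if TotDist p q = true then (1:ℤ) else 0))) := by
      simp only [sub_mul, mul_sub, Finset.sum_sub_distrib]
    rw [← e]
    exact Finset.sum_nonneg fun p _ => Finset.sum_nonneg fun q _ =>
      mul_nonneg (mul_nonneg (mul_nonneg (ind_nonneg' _ p) (ind_nonneg' _ q)) (by linarith [nQ01 q])) (by split_ifs <;> norm_num)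
  have fp1 : 0 ≤ (∑ p, ∑ q, ind P0 p * ind D q * ind Q2 q * (if TotDist p q = true then (1:ℤ) else 0)) - (∑ p, ∑ q, ind P0 p * ind D q * ind Q1 q * (if TotDist p q = true then (1:ℤ) else 0)) := by
    have e : (∑ p, ∑ q, ind P0 p * ind D q * (ind Q2 q - ind Q1 q) * (if TotDist p q = true then (1:ℤ) else 0)) = ((∑ p, ∑ q, ind P0 p * ind D q * ind Q2 q * (if TotDist p q = true then (1:ℤ) else 0)) - (∑ p, ∑ q, ind P0 p * ind D q * ind Q1 q * (if TotDist p q = true then (1:ℤ) else 0))) := by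
      simp only [sub_mul, mul_sub, Finset.sum_sub_distrib]
    rw [← e]
    exact Finset.sum_nonneg fun p _ => Finset.sum_nonneg fun q _ =>
      mul_nonneg (mul_nonneg (mul_nonneg (ind_nonneg' _ p) (ind_nonneg' _ q)) (by linarith [nQ12 q])) (by split_ifs <;> norm_num)
  have fp2 : 0 ≤ 2 ^ n * ((∑ p, ind (univ : Finset (Pd n)) p * ind P2 p * ind Q2 p) - (∑ p, ind (univ : Finset (Pd n)) p * ind P0 p * ind Q2 p) - (∑ p, ind D p * ind P2 p * ind Q2 p) + (∑ p, ind D p * ind P0 p * ind Q2 p)) := by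
    refine mul_nonneg (pow_nonneg (by norm_num) n) ?_
    have e : (∑ p, (ind (univ : Finset (Pd n)) p - ind D p) * (ind P2 p - ind P0 p) * ind Q2 p) = ((∑ p, ind (univ : Finset (Pd n)) p * ind P2 p * ind Q2 p) - (∑ p, ind (univ : Finset (Pd n)) p * ind P0 p * ind Q2 p) - (∑ p, ind D p * ind P2 p * ind Q2 p) + (∑ p, ind D p * ind P0 p * ind Q2 p)) := by
      simp only [sub_mul, mul_sub, Finset.sum_sub_distrib]; ring
    rw [← e]
    exact Finset.sum_nonneg fun p _ => mul_nonneg (mul_nonneg (by linarith [nDU p]) (by linarith [nP02 p])) (ind_nonneg' _ p)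
  have fp3 : 0 ≤ (∑ p, ∑ q, ind Q2 p * ind (univ : Finset (Pd n)) q * ind P2 q * (if TotDist p q = true then (1:ℤ) else 0)) - (∑ p, ∑ q, ind Q1 p * ind (univ : Finset (Pd n)) q * ind P2 q * (if TotDist p q = true then (1:ℤ) else 0)) - (∑ p, ∑ q, ind Q2 p * ind (univ : Finset (Pd n)) q * ind P0 q * (if TotDist p q = true then (1:ℤ) else 0)) + (∑ p, ∑ q, ind Q1 p * ind (univ : Finset (Pd n)) q * ind P0 q * (if TotDist p q = true then (1:ℤ) else 0)) := by
    have e : (∑ p, ∑ q, (ind Q2 p - ind Q1 p) * ind (univ : Finset (Pd n)) q * (ind P2 q - ind P0 q) * (if TotDist p q = true then (1:ℤ) else 0)) = ((∑ p, ∑ q, ind Q2 p * ind (univ : Finset (Pd n)) q * ind P2 q * (if TotDist p q = true then (1:ℤ) else 0)) - (∑ p, ∑ q, ind Q1 p * ind (univ : Finset (Pd n)) q * ind P2 q * (if TotDist p q = true then (1:ℤ) else 0)) - (∑ p, ∑ q, ind Q2 p * ind (univ : Finset (Pd n)) q * ind P0 q * (if TotDist p q = true then (1:ℤ) else 0)) +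 (∑ p, ∑ q, ind Q1 p * ind (univ : Finset (Pd n)) q * ind P0 q * (if TotDist p q = true then (1:ℤ) else 0))) := by
      simp only [sub_mul, mul_sub, Finset.sum_sub_distrib]; ring
    rw [← e]
    exact Finset.sum_nonneg fun p _ => Finset.sum_nonneg fun q _ =>
      mul_nonneg (mul_nonneg (mul_nonneg (by linarith [nQ12 p]) (ind_nonneg' _ q)) (by linarith [nP02 q])) (by split_ifs <;> norm_num)
  have fp4 : 0 ≤ 2 ^ n * ((∑ p, ind (univ : Finset (Pd n)) p * ind P0 p * ind Q2 p) - (∑ p, ind (univ : Finset (Pd n)) p * ind P0 p * ind Q0 p) - (∑ p, ind D p * ind P0 p * ind Q2 p) + (∑ p, ind D p * ind P0 p * ind Q0 p)) := by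
    refine mul_nonneg (pow_nonneg (by norm_num) n) ?_
    have e : (∑ p, (ind (univ : Finset (Pd n)) p - ind D p) * ind P0 p * (ind Q2 p - ind Q0 p)) = ((∑ p, ind (univ : Finset (Pd n)) p * ind P0 p * ind Q2 p) - (∑ p, ind (univ : Finset (Pd n)) p * ind P0 p * ind Q0 p) - (∑ p, ind D p * ind P0 p * ind Q2 p) + (∑ p, ind D p * ind P0 p * ind Q0 p)) := by
      simp only [sub_mul, mul_sub, Finset.sum_sub_distrib]; ring
    rw [← e]
    exact Finset.sum_nonneg fun p _ => mul_nonneg (mul_nonneg (by linarith [nDU p]) (ind_nonneg' _ p)) (by linarith [nQ02 p])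
  have fp5 : 0 ≤ (∑ q, ∑ r, ind P2 q * ind Q2 r * ind (univ : Finset (Pd n)) (thirdPt q r) * (if TotDist q r = true then (1:ℤ) else 0)) - (∑ q, ∑ r, ind P2 q * ind Q0 r * ind (univ : Finset (Pd n)) (thirdPt q r) * (if TotDist q r = true then (1:ℤ) else 0)) - (∑ q, ∑ r, ind P1 q * ind Q2 r * ind (univ : Finset (Pd n)) (thirdPt q r) * (if TotDist q r = true then (1:ℤ) else 0)) + (∑ q, ∑ r, ind P1 q * ind Q0 r * ind (univ : Finset (Pd n)) (thirdPt q r) * (if TotDist q r = true then (1:ℤ) else 0)) - (∑ q, ∑ r, ind P2 q * ind Q2 r * ind D (thirdPt q r) * (if TotDist q r = true then (1:ℤ) else 0)) + (∑ q, ∑ r, ind P2 q * ind Q0 r * ind D (thirdPt q r) * (if TotDist q r = true then (1:ℤ) else 0)) + (∑ q, ∑ r, ind P1 q * ind Q2 r * ind D (thirdPt q r) * (if TotDist q r = true then (1:ℤ) else 0)) - (∑ q, ∑ r, ind P1 q * ind Q0 r * ind D (thirdPt q r) * (if TotDist q r = true then (1:ℤ) else 0)) := by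
    have e : (∑ q, ∑ r, (ind P2 q - ind P1 q) * (ind Q2 r - ind Q0 r) * (ind (univ : Finset (Pd n)) (thirdPt q r) - ind D (thirdPt q r)) * (if TotDist q r = true then (1:ℤ) else 0)) = ((∑ q, ∑ r, ind P2 q * ind Q2 r * ind (univ : Finset (Pd n)) (thirdPt q r) * (if TotDist q r = true then (1:ℤ) else 0)) - (∑ q, ∑ r, ind P2 q * ind Q0 r * ind (univ : Finset (Pd n)) (thirdPt q r) * (if TotDist q r = true then (1:ℤ) else 0)) - (∑ q, ∑ r, ind P1 q * ind Q2 r * ind (univ : Finset (Pd n)) (thirdPt q r) * (if TotDist q r = true then (1:ℤ) else 0)) + (∑ q, ∑ r, ind P1 q * ind Q0 r * ind (univ : Finset (Pd n)) (thirdPt q r) * (if TotDist q r = true then (1:ℤ) else 0)) - (∑ q, ∑ r, ind P2 q * ind Q2 r * ind D (thirdPt q r) * (if TotDist q r = true then (1:ℤ) else 0)) + (∑ q, ∑ r, ind P2 q * ind Q0 r * ind D (thirdPt q r) * (if TotDist q r = true then (1:ℤ) else 0)) + (∑ q, ∑ r, ind P1 q * ind Q2 r * ind D (thirdPt q r) *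 (if TotDist q r = true then (1:ℤ) else 0)) - (∑ q, ∑ r, ind P1 q * ind Q0 r * ind D (thirdPt q r) * (if TotDist q r = true then (1:ℤ) else 0))) := by
      simp only [sub_mul, mul_sub, Finset.sum_sub_distrib]; ring
    rw [← e]
    exact Finset.sum_nonneg fun q _ => Finset.sum_nonneg fun r _ =>
      mul_nonneg (mul_nonneg (mul_nonneg (by linarith [nP12 q]) (by linarith [nQ02 r])) (by linarith [nDU (thirdPt q r)])) (by split_ifs <;> norm_num)
  have fp6 : 0 ≤ 2 ^ n * ((∑ p, ind D p * ind P0 p * ind Q1 p) - (∑ p, ind D p * ind P0 p * ind Q0 p)) := by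
    refine mul_nonneg (pow_nonneg (by norm_num) n) ?_
    have e : (∑ p, ind D p * ind P0 p * (ind Q1 p - ind Q0 p)) = ((∑ p, ind D p * ind P0 p * ind Q1 p) - (∑ p, ind D p * ind P0 p * ind Q0 p)) := by
      simp only [mul_sub, Finset.sum_sub_distrib]
    rw [← e]
    exact Finset.sum_nonneg fun p _ => mul_nonneg (mul_nonneg (ind_nonneg' _ p) (ind_nonneg' _ p)) (by linarith [nQ01 p])
  have fp7 : 0 ≤ 2 ^ n * ((∑ p, ind D p * ind P1 p * ind Q1 p) - (∑ p, ind D p * ind P0 p * ind Q1 p)) := by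
    refine mul_nonneg (pow_nonneg (by norm_num) n) ?_
    have e : (∑ p, ind D p * (ind P1 p - ind P0 p) * ind Q1 p) = ((∑ p, ind D p * ind P1 p * ind Q1 p) - (∑ p, ind D p * ind P0 p * ind Q1 p)) := by
      simp only [sub_mul, mul_sub, Finset.sum_sub_distrib]
    rw [← e]
    exact Finset.sum_nonneg fun p _ => mul_nonneg (mul_nonneg (ind_nonneg' _ p) (by linarith [nP01 p])) (ind_nonneg' _ p)
  have fp8 : 0 ≤ (∑ p, ∑ q, ind D p * ind P1 q * ind Q0 q * (if TotDist p q = true then (1:ℤ) else 0)) - (∑ p, ∑ q, ind D p * ind P0 q * ind Q0 q * (if TotDist p q = true then (1:ℤ) else 0)) := by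
    have e : (∑ p, ∑ q, ind D p * (ind P1 q - ind P0 q) * ind Q0 q * (if TotDist p q = true then (1:ℤ) else 0)) = ((∑ p, ∑ q, ind D p * ind P1 q * ind Q0 q * (if TotDist p q = true then (1:ℤ) else 0)) - (∑ p, ∑ q, ind D p * ind P0 q * ind Q0 q * (if TotDist p q = true then (1:ℤ) else 0))) := by
      simp only [sub_mul, mul_sub, Finset.sum_sub_distrib]
    rw [← e]
    exact Finset.sum_nonneg fun p _ => Finset.sum_nonneg fun q _ =>
      mul_nonneg (mul_nonneg (mul_nonneg (ind_nonneg' _ p) (by linarith [nP01 q])) (ind_nonneg' _ q)) (by split_ifs <;> norm_num)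
  have fp9 : 0 ≤ 2 ^ n * ((∑ p, ind (univ : Finset (Pd n)) p * ind P2 p * ind Q2 p) - (∑ p, ind (univ : Finset (Pd n)) p * ind P1 p * ind Q2 p) - (∑ p, ind D p * ind P2 p * ind Q2 p) + (∑ p, ind D p * ind P1 p * ind Q2 p)) := by
    refine mul_nonneg (pow_nonneg (by norm_num) n) ?_
    have e : (∑ p, (ind (univ : Finset (Pd n)) p - ind D p) * (ind P2 p - ind P1 p) * ind Q2 p) = ((∑ p, ind (univ : Finset (Pd n)) p * ind P2 p * ind Q2 p) - (∑ p, ind (univ : Finset (Pd n)) p * ind P1 p * ind Q2 p) - (∑ p, ind D p * ind P2 p * ind Q2 p) + (∑ p, ind D p * ind P1 p * ind Q2 p)) := by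
      simp only [sub_mul, mul_sub, Finset.sum_sub_distrib]; ring
    rw [← e]
    exact Finset.sum_nonneg fun p _ => mul_nonneg (mul_nonneg (by linarith [nDU p]) (by linarith [nP12 p])) (ind_nonneg' _ p)
  have fp10 : 0 ≤ 2 ^ n * ((∑ p, ind (univ : Finset (Pd n)) p * ind P1 p * ind Q2 p) - (∑ p, ind (univ : Finset (Pd n)) p * ind P1 p * ind Q1 p) - (∑ p, ind D p * ind P1 p * ind Q2 p) + (∑ p, ind D p * ind P1 p * ind Q1 p)) := by
    refine mul_nonneg (pow_nonneg (by norm_num) n) ?_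
    have e : (∑ p, (ind (univ : Finset (Pd n)) p - ind D p) * ind P1 p * (ind Q2 p - ind Q1 p)) = ((∑ p, ind (univ : Finset (Pd n)) p * ind P1 p * ind Q2 p) - (∑ p, ind (univ : Finset (Pd n)) p * ind P1 p * ind Q1 p) - (∑ p, ind D p * ind P1 p * ind Q2 p) + (∑ p, ind D p * ind P1 p * ind Q1 p)) := by
      simp only [sub_mul, mul_sub, Finset.sum_sub_distrib]; ring
    rw [← e]
    exact Finset.sum_nonneg fun p _ => mul_nonneg (mul_nonneg (by linarith [nDU p]) (ind_nonneg' _ p)) (by linarith [nQ12 p])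
  have fp11 : 0 ≤ (∑ p, ∑ q, ind Q2 p * ind D q * ind P2 q * (if TotDist p q = true then (1:ℤ) else 0)) - (∑ p, ∑ q, ind Q2 p * ind D q * ind P1 q * (if TotDist p q = true then (1:ℤ) else 0)) := by
    have e : (∑ p, ∑ q, ind Q2 p * ind D q * (ind P2 q - ind P1 q) * (if TotDist p q = true then (1:ℤ) else 0)) = ((∑ p, ∑ q, ind Q2 p * ind D q * ind P2 q * (if TotDist p q = true then (1:ℤ) else 0)) - (∑ p, ∑ q, ind Q2 p * ind D q * ind P1 q * (if TotDist p q = true then (1:ℤ) else 0))) := by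
      simp only [sub_mul, mul_sub, Finset.sum_sub_distrib]
    rw [← e]
    exact Finset.sum_nonneg fun p _ => Finset.sum_nonneg fun q _ =>
      mul_nonneg (mul_nonneg (mul_nonneg (ind_nonneg' _ p) (ind_nonneg' _ q)) (by linarith [nP12 q])) (by split_ifs <;> norm_num)
  have fp12 : 0 ≤ (∑ p, ∑ q, ind P2 p * ind D q * ind Q2 q * (if TotDist p q = true then (1:ℤ) else 0)) - (∑ p, ∑ q, ind P2 p * ind D q * ind Q1 q * (if TotDist p q = true then (1:ℤ) else 0)) - (∑ p, ∑ q, ind P1 p * ind D q * ind Q2 q * (if TotDist p q = true then (1:ℤ) else 0)) + (∑ p, ∑ q, ind P1 p * ind D q * ind Q1 q * (if TotDist p q = true then (1:ℤ) else 0)) := by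
    have e : (∑ p, ∑ q, (ind P2 p - ind P1 p) * ind D q * (ind Q2 q - ind Q1 q) * (if TotDist p q = true then (1:ℤ) else 0)) = ((∑ p, ∑ q, ind P2 p * ind D q * ind Q2 q * (if TotDist p q = true then (1:ℤ) else 0)) - (∑ p, ∑ q, ind P2 p * ind D q * ind Q1 q * (if TotDist p q = true then (1:ℤ) else 0)) - (∑ p, ∑ q, ind P1 p * ind D q * ind Q2 q * (if TotDist p q = true then (1:ℤ) else 0)) + (∑ p, ∑ q, ind P1 p * ind D q * ind Q1 q * (if TotDist p q = true then (1:ℤ) else 0))) := by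
      simp only [sub_mul, mul_sub, Finset.sum_sub_distrib]; ring
    rw [← e]
    exact Finset.sum_nonneg fun p _ => Finset.sum_nonneg fun q _ =>
      mul_nonneg (mul_nonneg (mul_nonneg (by linarith [nP12 p]) (ind_nonneg' _ q)) (by linarith [nQ12 q])) (by split_ifs <;> norm_num)
  have uT00 : 2 ^ n * (∑ p, ind (univ : Finset (Pd n)) p * ind P0 p * ind Q0 p) = 2 ^ n * (∑ p, ind P0 p * ind Q0 p) := by
    rw [normT]
  have uNA00 := normNA P0 Q0
  have uNB00 := normNB P0 Q0
  have uNC00 := normNC P0 Q0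
  have uL00 := normL P0 Q0
  have uT01 : 2 ^ n * (∑ p, ind (univ : Finset (Pd n)) p * ind P0 p * ind Q1 p) = 2 ^ n * (∑ p, ind P0 p * ind Q1 p) := by
    rw [normT]
  have uNA01 := normNA P0 Q1
  have uNB01 := normNB P0 Q1
  have uNC01 := normNC P0 Q1
  have uL01 := normL P0 Q1
  have uT02 : 2 ^ n * (∑ p, ind (univ : Finset (Pd n)) p * ind P0 p * ind Q2 p) = 2 ^ n * (∑ p, ind P0 p * ind Q2 p) := by
    rw [normT]
  have uNA02 := normNA P0 Q2
  have uNB02 := normNB P0 Q2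
  have uNC02 := normNC P0 Q2
  have uL02 := normL P0 Q2
  have uT10 : 2 ^ n * (∑ p, ind (univ : Finset (Pd n)) p * ind P1 p * ind Q0 p) = 2 ^ n * (∑ p, ind P1 p * ind Q0 p) := by
    rw [normT]
  have uNA10 := normNA P1 Q0
  have uNB10 := normNB P1 Q0
  have uNC10 := normNC P1 Q0
  have uL10 := normL P1 Q0
  have uT11 : 2 ^ n * (∑ p, ind (univ : Finset (Pd n)) p * ind P1 p * ind Q1 p) = 2 ^ n * (∑ p, ind P1 p * ind Q1 p) := by
    rw [normT]
  have uNA11 := normNA P1 Q1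
  have uNB11 := normNB P1 Q1
  have uNC11 := normNC P1 Q1
  have uL11 := normL P1 Q1
  have uT12 : 2 ^ n * (∑ p, ind (univ : Finset (Pd n)) p * ind P1 p * ind Q2 p) = 2 ^ n * (∑ p, ind P1 p * ind Q2 p) := by
    rw [normT]
  have uNA12 := normNA P1 Q2
  have uNB12 := normNB P1 Q2
  have uNC12 := normNC P1 Q2
  have uL12 := normL P1 Q2
  have uT20 : 2 ^ n * (∑ p, ind (univ : Finset (Pd n)) p * ind P2 p * ind Q0 p) = 2 ^ n * (∑ p, ind P2 p * ind Q0 p) := by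
    rw [normT]
  have uNA20 := normNA P2 Q0
  have uNB20 := normNB P2 Q0
  have uNC20 := normNC P2 Q0
  have uL20 := normL P2 Q0
  have uT21 : 2 ^ n * (∑ p, ind (univ : Finset (Pd n)) p * ind P2 p * ind Q1 p) = 2 ^ n * (∑ p, ind P2 p * ind Q1 p) := by
    rw [normT]
  have uNA21 := normNA P2 Q1
  have uNB21 := normNB P2 Q1
  have uNC21 := normNC P2 Q1
  have uL21 := normL P2 Q1
  have uT22 : 2 ^ n * (∑ p, ind (univ : Finset (Pd n)) p * ind P2 p * ind Q2 p) = 2 ^ n * (∑ p, ind P2 p * ind Q2 p) := by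
    rw [normT]
  have uNA22 := normNA P2 Q2
  have uNB22 := normNB P2 Q2
  have uNC22 := normNC P2 Q2
  have uL22 := normL P2 Q2
  rw [eS_A1_P1_Q1, eS_A1_P2_Q2, eS_U_P2_Q2, eA]
  linarith [fS_A2_P2_Q2, fkB112, fkC111, fp0, fp1, fp2, fp3, fp4, fp5, fp6, fp7, fp8, fp9, fp10, fp11, fp12, uT00, uNA00, uNB00, uNC00, uL00, uT01, uNA01, uNB01, uNC01, uL01, uT02, uNA02, uNB02, uNC02, uL02, uT10, uNA10, uNB10, uNC10, uL10, uT11, uNA11, uNB11, uNC11, uL11, uT12, uNA12, uNB12, uNC12, uL12, uT20, uNA20, uNB20, uNC20, uL20, uT21, uNA21, uNB21, uNC21, uL21, uT22, uNA22, uNB22, uNC22, uL22]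

end Summit.CriticalPhenomena.PercolationContinuityZ3.Theorems.SahiGridPattern
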